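import Summits.BirchSwinnertonDyer.BirchSwinnertonDyer.Theorems.GenusKolyvaginAtTwoGenusPrimitiveSupplyAtTwoTranspositionTwistLaw
import Literature.NumberTheory.EllipticCurves.TwoAdicImageQuadraticTwistProofs
import Literature.NumberTheory.EllipticCurves.SelmerGroupCardinality
import Summits.BirchSwinnertonDyer.Rank1Residual.F1Sign2.DoorVisibilityAtTwo
import HarnessLib.Audit.Tags
import HarnessLib

/-!
# Cell `bsd-f1-sign2`, descent lens (planner `-desc` g19, MEMO-desc §27-add1): «Ш[2] IN THE TRANSPOSITION DOOR» — non-archimedean one-bit doors on the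
# `Δ_W < 0` residue (D-desc-69-add port; FIVE KERNEL theorems ET/RT/LT/XT/YT + BSD₂ candidate rows TT/ST (+ REF1's ST′) as `@[conjecture]` defs);
# SIBLING of `F1Sign2/DoorVisibilityAtTwo.lean` (§27, `Δ_W > 0`, archimedean doors) — `shaTwoCard` is SHARED with that file (one declaration, REF1 §149 (iii)).

PORT (cell `bsd-f1-sign2`, seat `-ty` g13, ask D-desc-69-add, INBOX 2026-08-28T22:58:03Z) of -desc g19's
`HOME/MEMO-desc-data/g19/transp/lean/SketchG19TranspDoorVisibility.lean` (sha16 e569e01c8b2a5ed4; MEMO-desc §27-add1 «Ш[2] IN THE TRANSPOSITION DOOR»,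
HOME/MEMO-desc.md l.2226–2336; census kit §27-add1 PT-1…PT-7, two engines per quantity, 0 violations).  Bodies VERBATIM from the sketch, in the sketch's
order, namespace `…F1Sign2.TranspDoorVisibility` as in the sketch; the typer's only edits are this header, the imports of `F1Sign2.DoorVisibilityAtTwo` /
`HarnessLib`, the REMOVAL of the sketch's duplicate `shaTwoCard` (the §27 file's `Summit.BirchSwinnertonDyer.Rank1Residual.F1Sign2.shaTwoCard` — same body
`Nat.card ↥(W.sha ⊓ AddSubgroup.torsionBy W.galH1 2)` — is used through `open …F1Sign2`), docstrings on the five `_holds` theorems (gate lint), ONE cast-normalisation line `rw [Nat.cast_ofNat] at hsha` in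
`selmerTwoCard_eq_eight_of_residueNeg` (the shared `shaTwoCard` spells the level `((2 : ℕ) : ℤ)`, the sketch's copy spelt it `2`), the sketch's unneeded `set_option linter.dupNamespace false` dropped, `@[conjecture]`
on TT/ST (REF1 §149 (ii)) with REF1/REF2 riders in their docstrings, and REF1's rider ST′ + kernel glue at the end (typed VERBATIM from `Probe149.lean`).
CONTENT.  On the `Δ < 0` residue `OnResidueNegAtTwo W` (:≡ `W.Δ < 0 ∧ NoRationalTwoTorsion W ∧ rank 1 ∧ #Ш(W)[2] = 4`) every MET TRANSPOSITION door
(`TranspAdmissible W d q₀ ∧ MeetsNonNormAt W q₀`: one ramified place `q₀` with `dim W(ℚ_{q₀})[2] = 1`, the generator meeting the non-norm coset) has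
`Sel₂(W^{(d)}) = ker(loc_{q₀} | Sel₂(W)) ≅ Ш(W)[2]`.  KERNEL (proved in this file, std axioms): **ET `transpDoorDownLawAtTwo_holds`** (`W.Δ < 0 →
TranspAdmissible W d q₀ → MeetsNonNormAt W q₀ → 2·#Sel₂(W^d) = #Sel₂(W)` — the DOWN half of the tree's T-q₀ `GenusKolyTransp.transpositionTwistLawAtTwo_holds`,
hypothesis-free in rank / torsion / Ш: menu frame `natCard_selmerGroup_twist_directed_of_menu_frame` at `T = {q₀}`, `Δ(W^d) = d⁶Δ < 0` ⇒ no ∞-term),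
**RT `residueNegDoorSelmerFourAtTwo_holds`** (`#Sel₂(W^d) = 4`), **LT `residueNegDoorRankLeTwoAtTwo_holds`** (rank `W^d ≤ 2`),
**XT `residueNegDoorShaTwoTransportCardAtTwo_holds`** (rank-0 twin ⇒ `#Ш(W^d)[2] = 4`: TRANSPORT — how Kramer 1981 §3 manufactures `Ш(E^d)[2] ≠ 0`, with
Ш(W)[2] in the rôle of the generator), **YT `residueNegDoorShaTwoDissolvedCardAtTwo_holds`** (rank-2 twin ⇒ `Ш(W^d)[2] = 0`: DISSOLUTION); helper
`selmerTwoCard_eq_eight_of_residueNeg`.  TYPED BSD₂ CANDIDATES (`@[conjecture] def`s, nothing asserted): TT `ResidueNegDoorVisibleFourAtTwo` (twin with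
`L(W^d,1) ≠ 0` ⇒ `Ш_an(W^d) ∈ ℚ` with `v₂ ≥ 2`; census PT-3 10 033/0), ST `ResidueNegDoorDissolvedOddAtTwo` (twin of analytic rank 2 ⇒ `Ш_an` a 2-adic unit;
PT-4 4 407/0; INCLUDES the rank conjecture at r_an = 2 — REF1) and REF1's preferred ST′ `ResidueNegDoorDissolvedOddAtTwoMW` (+ binder `Wd.mordellWeilRank = 2`)
with `dissolvedOddMW_of_dissolvedOdd : ST → ST′`.  Habitat witness (REF1): 26743b1 — door (−231, 3) a TT instance (dim Sel₂(W^d) = 2, r_an 0, Ш_an(W^d) = 4),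
door (−127, 127) an ST′ instance (r_an = r_MW = 2, Ш_an = 1).
REF1 §149 = D-desc-70 add1 (refuter-bsd-f1-sign2-ref1 g14, `HOME/REF1-AUDIT-v1.md` §149 l.2881–2896; evidence `HOME/REF1-data/b149/` — `lean/Probe149.lean`
bc5acd0a7fbd8e46 = the sketch verbatim in ns `…F1Sign2.REF1g14b` + probes, farm rc 0; INBOX 2026-08-28T23:31:58Z) ONE LINE verbatim: «D-desc-70 add1 DONE:
§27T transp-door sketch e569e01c8b2a5ed4 AUDITED — ET/RT/LT/XT/YT PROVED rows confirmed kernel (all five `_holds` std axioms from this seat); TT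
`ResidueNegDoorVisibleFourAtTwo` SURVIVES conjecture-grade (BSD₂ of the rank-0 transposition twin to 2²); ST `ResidueNegDoorDissolvedOddAtTwo` SURVIVES as typed
but bundles «r_an(W^d)=2 ⇒ r_MW=2» exactly as §146 S ⇒ rider ST′ `ResidueNegDoorDissolvedOddAtTwoMW` (+ binder `Wd.mordellWeilRank = 2 →`) with kernel glue
`dissolvedOddMW_of_dissolvedOdd : ST → ST′; 0 killed» — -ty instructions APPLIED: (i) ET–YT filed with their proofs as they stand; (ii) TT/ST tagged
`@[conjecture]`; ST′ typed in addition (preferred body) with the glue; (iii) `shaTwoCard` shared with the §27 file, `OnResidueNegAtTwo` declared once here;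
(iv) the §27 file's adapters `shaTwoToPrimary` / `shaTwoCard_dvd_natCard_primaryComponent` apply verbatim (they are stated for every `W`).  Mutation audit
(REF1): every clause of `TranspAdmissible` + `MeetsNonNormAt` + `Δ < 0` is load-bearing in ET; `NoRationalTwoTorsion` correctly absent from ET / present in
RT–YT; Ш-met DOWN doors (Pdiv = 1) are outside TT/ST's quantifier — information, not a defect.
REF2 v43 §3 (refuter-bsd-f1-sign2-ref2 g43, `HOME/REF2-PLACEMENT-v43.md` c250020aefbafc74, INBOX 2026-08-28T23:32:14Z; text §3.5 verbatim): «PLACEMENT (REF2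
v43 §3): mechanism = Mazur–Rubin 2010 Lemma 2.11 (ramified place ⇒ transversal Kummer lines), Prop. 3.3, Cor. 3.4 (i) with T = {q₀} [cite: MazurRubin2010,
Lemma 2.11, Prop. 3.3, Cor. 3.4] + Kramer 1981 Prop. 3, Thm. 1 [cite: Kramer1981, Prop. 3, Thm. 1] + Poitou–Tate (tree §79). Rows ET/RT/LT/XT/YT: known
mechanism, kernel-proved here (ET = the tree's `TranspositionTwistLawAtTwo` DOWN half with the rank-1 / no-2-torsion / `ShaTwoTrivial` hypotheses removed).
Candidates TT/ST: not in print at p = 2 — visible L-value factors are printed for odd primes only [cite: Agashe2010]; the 2-adic twist-value theorems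
[cite: Zhai2016, Thm. 1.1, Thm. 1.2] need a rank-0 base and a_q odd twisting primes, while a transposition prime has a_{q₀} even; conjecture-grade, census
PT-3/PT-4. [cite: CremonaMazur2000] [cite: Bruin2004, Thm. 1.2]»; grade NEW-COMBINATION only as typed (same class as §27's T/T♯/S, REF2 v41 §2).
PARTITION: none moved (the twins are outside the referee desks' ranges); beyond-print theorem: no (ET–YT formalise a known mechanism; TT/ST/ST′ are
BSD-slices, conjecture-grade); BSD is not proved; stmt-23715 is not closed by anything here.

## The sketch's own summary (verbatim)

# Cell `bsd-f1-sign2`, seat `-desc` g19 — MEMO-desc §27-add1: `Ш(W)[2]` IN THE TRANSPOSITION DOOR (`Δ_W < 0`)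

Sketch (planner scratch, not a tree file).  The `Δ < 0` half of §27: at a transposition-admissible `(d, q₀)`
(`F1Sign2.TranspositionDoor.TranspAdmissible W d q₀`: `d < 0`, `d ≡ 1 (8)`, squares at the odd bad primes, `q₀ ∣ d` the unique prime with
`Frob_{q₀}` a transposition on `W[2]`, the other primes of `d` of `3`-cycle type) the Mazur–Rubin comparison set is `T = {q₀}` and the
DOWN direction `MeetsNonNormAt W q₀` (`E(ℚ) ⊄ 2E(ℚ_{q₀})`, Kramer's non-norm coset) gives `#Sel₂(W^{(d)}) · 2 = #Sel₂(W)` with NO hypothesis on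
`Ш(W)[2]` (row ET, derived here from the tree's §79 `natCard_selmerGroup_twist_directed_of_menu_frame` exactly as gk2-p4's
`transpositionTwistLawAtTwo_holds`, minus the `ShaTwoTrivial` step).  On the `Δ < 0` residue (`E(ℚ)[2] = 0`, rank `1`, `#Ш(W)[2] = 4`, so
`#Sel₂(W) = 8`) this yields `#Sel₂(W^{(d)}) = 4` (row RT), rank `W^{(d)} ≤ 2` (row LT), and the cardinal TRANSPORT / DISSOLUTION rows XT / YT
(`#Ш(W^{(d)})[2] = 4` at a rank-`0` twin, `= 1` at a rank-`2` twin).  BSD is not proved by any of this; no item is closed.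

References: [MazurRubin2010] Prop. 3.3, Cor. 3.4 (i); [Kramer1981] Prop. 3, Thm. 1; [MilneADT2006] I Thm. 2.8, 4.10.
-/

set_option autoImplicit false

noncomputable section

open scoped Classical ContRepresentation

namespace Summit.BirchSwinnertonDyer.Rank1Residual.F1Sign2.TranspDoorVisibility

open WeierstrassCurve Field NumberField IsDedekindDomain Function
open Literature.NumberTheory.EllipticCurves Literature.NumberTheory.GaloisRepresentations
open Literature.NumberTheory.GaloisRepresentations.IsNonarchimedeanLocalField
open Literature.NumberTheory.GaloisCohomology
open Rat.HeightOneSpectrum (primesEquiv natGenerator)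
open Summit.BirchSwinnertonDyer.Rank1Residual.F1Sign2
open Summit.BirchSwinnertonDyer.Rank1Residual.F1Sign2.TranspositionDoor (TranspAdmissible MeetsNonNormAt)
open Summit.BirchSwinnertonDyer.BirchSwinnertonDyer.Theorems
open Summit.BirchSwinnertonDyer.BirchSwinnertonDyer.Theorems.GenusKolyTwistLocal
open Summit.BirchSwinnertonDyer.BirchSwinnertonDyer.Theorems.GenusKolyArch
open Summit.BirchSwinnertonDyer.BirchSwinnertonDyer.Theorems.GenusKolyTransp
open Summit.BirchSwinnertonDyer.BirchSwinnertonDyer.Theorems.GenusKolyTwistingPrime (primesEquiv_eq natCast_not_mem_of_not_dvd)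
open Summit.BirchSwinnertonDyer.BirchSwinnertonDyer.Theorems.GenusKolyTwistRamified
  (valuation_natCast_eq_exp_neg_one_of_mem closureEmb_geomSqrt_not_mem_maxUnramified_rat)
open Summit.BirchSwinnertonDyer.BirchSwinnertonDyer.Theorems.RankOneAtTwoOneDoor (natCard_ker_nsmul_adicCompletion_two_eq_two_of_jacobiSym)

/-- The `Δ < 0` residue of the cell's leaf: no rational `2`-torsion, Mordell–Weil rank `1`, `#Ш(W)[2] = 4` (no egg exists at `Δ < 0`). -/
def OnResidueNegAtTwo (W : WeierstrassCurve ℚ) : Prop :=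
  W.Δ < 0 ∧ NoRationalTwoTorsion W ∧ W.mordellWeilRank = 1 ∧ shaTwoCard W = 4

/-- **DESC-27-ET `TranspDoorDownLawAtTwo` (THEOREM, hypothesis-free DOWN law at a transposition door).** `Δ_W < 0`, `(d, q₀)`
transposition-admissible, `E(ℚ)` meets the non-norm coset at `q₀`: `2 · #Sel₂(W^{(d)}) = #Sel₂(W)`.  No hypothesis on `E(ℚ)[2]`, the rank or `Ш`.
[cite: MazurRubin2010, Prop. 3.3, Cor. 3.4 (i)] [cite: Kramer1981, Prop. 3, Thm. 1] -/
def TranspDoorDownLawAtTwo : Prop :=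
  ∀ (W : WeierstrassCurve ℚ) [W.IsElliptic] [W.IsGloballyMinimal] [W.IsIntegral ℤ], W.Δ < 0 →
    ∀ (d : ℤ) (q₀ : ℕ) [Fact q₀.Prime], TranspAdmissible W d q₀ → MeetsNonNormAt W q₀ →
      2 * twistSelmerTwoCard W d = selmerTwoCard W

/-- **DESC-27-ET HOLDS** (kernel; -desc g19): the DOWN half of T-q₀ `TranspositionTwistLawAtTwo`, hypothesis-free in rank/torsion/Ш — menu frame `natCard_selmerGroup_twist_directed_of_menu_frame` at `T = {q₀}` + the local counts at `q₀`, at the squares and at `2` (`d ≡ 1 (8)`); `Δ(W^d) < 0` ⇒ no archimedean term. -/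
theorem transpDoorDownLawAtTwo_holds : TranspDoorDownLawAtTwo := by
  intro W _ _ _ hΔ d q₀ _ hadm hmeets
  have hd := hadm
  obtain ⟨hdneg, hsf, hd8, hq₀, hq₀d, hjac, hprimes, -⟩ := hadm
  -- the place of the door prime
  obtain ⟨v₀, hv₀⟩ : ∃ v₀ : HeightOneSpectrum (𝓞 ℚ), (q₀ : 𝓞 ℚ) ∈ v₀.asIdeal :=
    ⟨primesEquiv.symm ⟨q₀, hq₀⟩, by
      have h := Rat.HeightOneSpectrum.natCast_natGenerator_mem (primesEquiv.symm ⟨q₀, hq₀⟩)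
      rwa [show natGenerator (primesEquiv.symm ⟨q₀, hq₀⟩) = q₀ from
        congrArg Subtype.val (primesEquiv.apply_symm_apply (⟨q₀, hq₀⟩ : Nat.Primes))] at h⟩
  have hq₀2 : q₀ ≠ 2 := by
    rintro rfl
    have h2d : (2 : ℤ) ∣ d := by exact_mod_cast hq₀d
    omega
  have hn2 : ¬ q₀ ∣ 2 := fun h ↦ hq₀2 ((Nat.prime_dvd_prime_iff_eq hq₀ Nat.prime_two).mp h)
  have hgood₀ : W.HasGoodReductionAtPrime q₀ := (hprimes q₀ hq₀ hq₀d).1 inferInstance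
  have hq₀Δ : ¬ (q₀ : ℤ) ∣ minimalDiscriminantInt W := W.not_dvd_minimalDiscriminantInt_of_hasGoodReductionAtPrime' _ hgood₀
  have hq₀Δ' : ¬ (q₀ : ℤ) ∣ W.Δ.num := by rwa [← cast_minimalDiscriminantInt W, Rat.num_intCast]
  -- the `T`-place facts at `v₀`
  have h2v₀ : ((2 : ℕ) : 𝓞 ℚ) ∉ v₀.asIdeal := natCast_not_mem_of_not_dvd hq₀ hv₀ hn2
  have hv₀W : W.HasGoodReductionAt v₀ := by
    obtain hpq := primesEquiv_eq hq₀ hv₀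
    subst hpq
    exact (hasGoodReductionAtPrime_iff_hasGoodReductionAt_ringOfIntegers v₀ W).mp hgood₀
  have hram : closureEmb (K := ℚ) (v₀.adicCompletion ℚ) (geomSqrt ((d : ℤ) : ℚ)) ∉ maxUnramified (v₀.adicCompletion ℚ) := by
    apply closureEmb_geomSqrt_not_mem_maxUnramified_rat v₀
    obtain ⟨m, hm⟩ := hq₀d
    have hqm : ¬ (q₀ : ℤ) ∣ m := fun hm' ↦ by
      have hsq : (q₀ : ℤ) * q₀ ∣ d := by rw [hm]; exact mul_dvd_mul_left _ hm'
      have hu := hsf _ hsq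
      rw [Int.isUnit_iff] at hu
      rcases hu with hu | hu
      · exact hq₀.one_lt.ne' (by exact_mod_cast hu)
      · have : (0 : ℤ) ≤ (q₀ : ℤ) := by positivity
        omega
    rw [show ((d : ℤ) : ℚ) = ((q₀ : ℕ) : ℚ) * ((m : ℤ) : ℚ) by rw [hm]; push_cast; ring, Valuation.map_mul,
      valuation_natCast_eq_exp_neg_one_of_mem v₀ hq₀ hv₀, valuation_intCast_eq_one_of_not_dvd (K := ℚ) (v := v₀) hq₀ hv₀ hqm,
      mul_one]
  have ht : Nat.card (nsmulAddMonoidHom 2 : (W.baseChange (v₀.adicCompletion ℚ)).toAffine.Point →+ _).ker = 2 :=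
    natCard_ker_nsmul_adicCompletion_two_eq_two_of_jacobiSym W hq₀2 hgood₀ hq₀Δ' hjac hv₀
  -- the twist
  have hd0 : d ≠ 0 := hdneg.ne
  have hdQ : ((d : ℤ) : ℚ) ≠ 0 := by exact_mod_cast hd0
  haveI := W.isElliptic_quadraticTwist hdQ
  set Wd : WeierstrassCurve ℚ := W.quadraticTwist ((d : ℤ) : ℚ) with hWd
  have hC : (1 : VariableChange ℚ) • W.quadraticTwist ((d : ℤ) : ℚ) = Wd := one_smul _ _
  obtain ⟨φ, ψ, hψφ, hφψ, -⟩ := exists_intertwining_hsplit W hdQ hC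
  -- the menus
  have hfin := transpAdmissible_place_menu W hd hv₀ hC φ ψ hψφ hφψ
  have hinf : ∀ w : InfinitePlace ℚ,
      (∃ s : w.Completion, s ^ 2 = algebraMap ℚ w.Completion ((d : ℤ) : ℚ)) ∨
      ((∀ y : galoisCohomology (W.localGaloisModule w.Completion) 1, y = 0) ∧
        (∀ y : galoisCohomology (Wd.localGaloisModule w.Completion) 1, y = 0)) := by
    intro w
    right
    have hneg' : Wd.Δ < 0 := by
      rw [hWd, quadraticTwist_Δ]
      exact mul_neg_of_pos_of_neg (by positivity) hΔ
    exact ⟨fun y ↦ GenusExact.ArchVanishing.localH1_infinitePlace_eq_zero_of_Δ_neg W w hΔ y,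
      fun y ↦ GenusExact.ArchVanishing.localH1_infinitePlace_eq_zero_of_Δ_neg _ w hneg' y⟩
  obtain ⟨-, hdown⟩ := natCard_selmerGroup_twist_directed_of_menu_frame W Wd hdQ hC v₀ h2v₀ hv₀W hram ht hfin hinf
  have hmodel : Nat.card (Wd.selmerGroup ((2 : ℕ) : ℤ)) = twistSelmerTwoCard W d := by
    rw [Nat.cast_ofNat]
    exact GenusKolyTwin.natCard_selmerGroup_model_eq_twistSelmerTwoCard W hd0 Wd ⟨1, hC⟩
  have hSelW : Nat.card (W.selmerGroup ((2 : ℕ) : ℤ)) = selmerTwoCard W := by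
    rw [Nat.cast_ofNat]; rfl
  have h := hdown (exists_mem_selmerGroup_localization_ne_zero_of_meetsNonNormAt W v₀ hv₀ hq₀2 hq₀Δ hmeets)
  rw [hmodel, hSelW] at h
  omega

/-- Descent count on the `Δ < 0` residue: `#Sel₂(W) = 2¹ · 1 · 4 = 8`. -/
theorem selmerTwoCard_eq_eight_of_residueNeg (W : WeierstrassCurve ℚ) [W.IsElliptic]
    (h : OnResidueNegAtTwo W) : selmerTwoCard W = 8 := by
  obtain ⟨_, hT, hrank, hsha⟩ := h
  have hinst : (instDecidableEqRat : DecidableEq ℚ) = fun a b => Classical.propDecidable (a = b) := Subsingleton.elim _ _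
  have ht : Nat.card (AddSubgroup.torsionBy W.toAffine.Point ((2 : ℕ) : ℤ)) = 1 := by
    have hbot : AddSubgroup.torsionBy W.toAffine.Point ((2 : ℕ) : ℤ) = ⊥ :=
      (AddSubgroup.eq_bot_iff_forall _).mpr fun P hP ↦
        EggDoubling.eq_zero_of_two_smul_eq_zero W hT P (AddSubgroup.torsionBy.nsmul_iff.mp hP)
    rw [hbot, AddSubgroup.card_bot]
  rw [hinst] at ht
  have h := card_selmerGroup_eq_pow_rank_mul W 2
  unfold shaTwoCard at hsha
  rw [Nat.cast_ofNat] at hsha -- typer: the shared `F1Sign2.shaTwoCard` spells the level `((2 : ℕ) : ℤ)`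
  rw [ht] at h
  rw [Nat.cast_ofNat] at h
  rw [hsha, hrank] at h
  unfold selmerTwoCard
  rw [h]
  norm_num

/-- **DESC-27-RT `ResidueNegDoorSelmerFourAtTwo` (THEOREM).** On the `Δ < 0` residue, at a transposition door met by `E(ℚ)`:
`#Sel₂(W^{(d)}) = 4` (`= #Ш(W)[2]`). -/
def ResidueNegDoorSelmerFourAtTwo : Prop :=
  ∀ (W : WeierstrassCurve ℚ) [W.IsElliptic] [W.IsGloballyMinimal] [W.IsIntegral ℤ], OnResidueNegAtTwo W →
    ∀ (d : ℤ) (q₀ : ℕ) [Fact q₀.Prime], TranspAdmissible W d q₀ → MeetsNonNormAt W q₀ → twistSelmerTwoCard W d = 4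

/-- **DESC-27-RT HOLDS** (kernel; -desc g19): `#Sel₂(W) = 8` on the `Δ < 0` residue and the DOWN law ET. -/
theorem residueNegDoorSelmerFourAtTwo_holds : ResidueNegDoorSelmerFourAtTwo := fun W _ _ _ h d q₀ _ hd hm ↦ by
  have h8 := selmerTwoCard_eq_eight_of_residueNeg W h
  have h2 := transpDoorDownLawAtTwo_holds W h.1 d q₀ hd hm
  omega

/-- **DESC-27-LT `ResidueNegDoorRankLeTwoAtTwo` (THEOREM).** On the `Δ < 0` residue the twin at a met transposition door has rank `≤ 2`. -/
def ResidueNegDoorRankLeTwoAtTwo : Prop :=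
  ∀ (W : WeierstrassCurve ℚ) [W.IsElliptic] [W.IsGloballyMinimal] [W.IsIntegral ℤ], OnResidueNegAtTwo W →
    ∀ (d : ℤ) (q₀ : ℕ) [Fact q₀.Prime], TranspAdmissible W d q₀ → MeetsNonNormAt W q₀ →
      (W.quadraticTwist (d : ℚ)).mordellWeilRank ≤ 2

/-- **DESC-27-LT HOLDS** (kernel; -desc g19): `2^rank(W^d) ∣ #Sel₂(W^d) = 4` (no rational 2-torsion is twist-invariant). -/
theorem residueNegDoorRankLeTwoAtTwo_holds : ResidueNegDoorRankLeTwoAtTwo := fun W _ _ _ h d q₀ _ hd hm ↦ by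
  have h4 := residueNegDoorSelmerFourAtTwo_holds W h d q₀ hd hm
  have hd0 : (d : ℚ) ≠ 0 := by exact_mod_cast (ne_of_lt hd.1)
  haveI := W.isElliptic_quadraticTwist hd0
  have hc := card_selmerGroup_eq_pow_rank_mul (W.quadraticTwist (d : ℚ)) 2
  unfold twistSelmerTwoCard at h4
  rw [Nat.cast_ofNat] at hc
  rw [hc] at h4
  set r := (W.quadraticTwist (d : ℚ)).mordellWeilRank with hr
  have hdvd : 2 ^ r ∣ 4 := ⟨_, by rw [← h4, mul_assoc]⟩
  have hle : 2 ^ r ≤ 2 ^ 2 := Nat.le_of_dvd (by norm_num) hdvd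
  exact (Nat.pow_le_pow_iff_right (by norm_num)).mp hle

/-- **DESC-27-XT `ResidueNegDoorShaTwoTransportCardAtTwo` (THEOREM-grade; TRANSPORT at `Δ < 0`).** On the `Δ < 0` residue, at a met
transposition door whose twin has Mordell–Weil rank `0`: `#Ш(W^{(d)})[2] = 4 = #Ш(W)[2]`. -/
def ResidueNegDoorShaTwoTransportCardAtTwo : Prop :=
  ∀ (W : WeierstrassCurve ℚ) [W.IsElliptic] [W.IsGloballyMinimal] [W.IsIntegral ℤ], OnResidueNegAtTwo W →
    ∀ (d : ℤ) (q₀ : ℕ) [Fact q₀.Prime], TranspAdmissible W d q₀ → MeetsNonNormAt W q₀ →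
      (W.quadraticTwist (d : ℚ)).mordellWeilRank = 0 → shaTwoCard (W.quadraticTwist (d : ℚ)) = 4

/-- **DESC-27-XT HOLDS** (kernel; -desc g19): TRANSPORT — a rank-0 twin has `#Ш(W^d)[2] = #Sel₂(W^d) = 4`. -/
theorem residueNegDoorShaTwoTransportCardAtTwo_holds : ResidueNegDoorShaTwoTransportCardAtTwo :=
    fun W _ _ _ h d q₀ _ hd hm hr0 ↦ by
  have h4 := residueNegDoorSelmerFourAtTwo_holds W h d q₀ hd hm
  have hd0 : (d : ℚ) ≠ 0 := by exact_mod_cast (ne_of_lt hd.1)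
  haveI := W.isElliptic_quadraticTwist hd0
  have hT1 : ∀ P : W.toAffine.Point, 2 • P = 0 → P = 0 :=
    fun P hP ↦ EggDoubling.eq_zero_of_two_smul_eq_zero W h.2.1 P hP
  have hT2 : ∀ P : (W.quadraticTwist (d : ℚ)).toAffine.Point, 2 • P = 0 → P = 0 :=
    (forall_two_nsmul_quadraticTwist_iff W hd0).mpr hT1
  have hinst : (instDecidableEqRat : DecidableEq ℚ) = fun a b => Classical.propDecidable (a = b) := Subsingleton.elim _ _
  have ht : Nat.card (AddSubgroup.torsionBy (W.quadraticTwist (d : ℚ)).toAffine.Point ((2 : ℕ) : ℤ)) = 1 := by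
    have hbot : AddSubgroup.torsionBy (W.quadraticTwist (d : ℚ)).toAffine.Point ((2 : ℕ) : ℤ) = ⊥ :=
      (AddSubgroup.eq_bot_iff_forall _).mpr fun P hP ↦ hT2 P (AddSubgroup.torsionBy.nsmul_iff.mp hP)
    rw [hbot, AddSubgroup.card_bot]
  rw [hinst] at ht
  have hc := card_selmerGroup_eq_pow_rank_mul (W.quadraticTwist (d : ℚ)) 2
  rw [ht, hr0, pow_zero, one_mul, one_mul, Nat.cast_ofNat] at hc
  unfold twistSelmerTwoCard at h4
  rw [hc] at h4
  exact h4

/-- **DESC-27-YT `ResidueNegDoorShaTwoDissolvedCardAtTwo` (THEOREM-grade; DISSOLUTION at `Δ < 0`).** On the `Δ < 0` residue, at a met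
transposition door whose twin has Mordell–Weil rank `2`: `Ш(W^{(d)})[2] = 0`. -/
def ResidueNegDoorShaTwoDissolvedCardAtTwo : Prop :=
  ∀ (W : WeierstrassCurve ℚ) [W.IsElliptic] [W.IsGloballyMinimal] [W.IsIntegral ℤ], OnResidueNegAtTwo W →
    ∀ (d : ℤ) (q₀ : ℕ) [Fact q₀.Prime], TranspAdmissible W d q₀ → MeetsNonNormAt W q₀ →
      (W.quadraticTwist (d : ℚ)).mordellWeilRank = 2 → shaTwoCard (W.quadraticTwist (d : ℚ)) = 1

/-- **DESC-27-YT HOLDS** (kernel; -desc g19): DISSOLUTION — a rank-2 twin has `#Ш(W^d)[2] = 4/2² = 1`. -/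
theorem residueNegDoorShaTwoDissolvedCardAtTwo_holds : ResidueNegDoorShaTwoDissolvedCardAtTwo :=
    fun W _ _ _ h d q₀ _ hd hm hr2 ↦ by
  have h4 := residueNegDoorSelmerFourAtTwo_holds W h d q₀ hd hm
  have hd0 : (d : ℚ) ≠ 0 := by exact_mod_cast (ne_of_lt hd.1)
  haveI := W.isElliptic_quadraticTwist hd0
  have hT1 : ∀ P : W.toAffine.Point, 2 • P = 0 → P = 0 :=
    fun P hP ↦ EggDoubling.eq_zero_of_two_smul_eq_zero W h.2.1 P hP
  have hT2 : ∀ P : (W.quadraticTwist (d : ℚ)).toAffine.Point, 2 • P = 0 → P = 0 :=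
    (forall_two_nsmul_quadraticTwist_iff W hd0).mpr hT1
  have hinst : (instDecidableEqRat : DecidableEq ℚ) = fun a b => Classical.propDecidable (a = b) := Subsingleton.elim _ _
  have ht : Nat.card (AddSubgroup.torsionBy (W.quadraticTwist (d : ℚ)).toAffine.Point ((2 : ℕ) : ℤ)) = 1 := by
    have hbot : AddSubgroup.torsionBy (W.quadraticTwist (d : ℚ)).toAffine.Point ((2 : ℕ) : ℤ) = ⊥ :=
      (AddSubgroup.eq_bot_iff_forall _).mpr fun P hP ↦ hT2 P (AddSubgroup.torsionBy.nsmul_iff.mp hP)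
    rw [hbot, AddSubgroup.card_bot]
  rw [hinst] at ht
  have hc := card_selmerGroup_eq_pow_rank_mul (W.quadraticTwist (d : ℚ)) 2
  rw [ht, hr2, mul_one, Nat.cast_ofNat] at hc
  unfold twistSelmerTwoCard at h4
  rw [hc] at h4
  exact Nat.eq_of_mul_eq_mul_left (show 0 < 2 ^ 2 by norm_num) (h4.trans (by norm_num))

/-- **DESC-27-TT `ResidueNegDoorVisibleFourAtTwo` (BSD₂ CANDIDATE, the `Δ < 0` analogue of DESC-27-T).** On the `Δ < 0` residue, at a met
transposition door whose twin has `L(W^{(d)}, 1) ≠ 0`: `#Ш_an` of a minimal model of the twin is a rational number of `2`-adic valuation `≥ 2`.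
Census §27-add1 (PT-3: 10 033/0 over all DOWN rank-0 doors, P-met subset 5 404/0; PT-3a θ-split for free: s = 2 ⇒ v₂(Ш_an) = 2 exactly 7 097, R − r = 2 ⇒ v₂ ≥ 4 2 936).
REF1 §149: SURVIVES, CONJECTURE-GRADE (BSD₂ of the rank-0 transposition twin, lower bound 2²; typed correctly; = §146 T with the door changed: habitat +
`L(E^d,1) ≠ 0` ⇒ (Kolyvagin, print) rank 0 ⇒ XT (kernel) `#Ш(E^d)[2] = 4`; `Ш_an = L(E^d,1)·T²/(Ω·Tam)` rational (print); BSD₂ predicts `v₂ ≥ 2`; no hidden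
hypothesis).  REF2 v43 §3: NOT IN PRINT at p = 2 for quadratic twists ([cite: Agashe2010] odd p only; [cite: Zhai2016, Thm. 1.1, Thm. 1.2] needs a rank-0 base and
a_q odd, a transposition prime has a_{q₀} even) ⇒ NEW-COMBINATION as typed, conjecture-grade.  `@[conjecture]`: a BSD₂-slice, nothing asserted.
[cite: Kramer1981, Thm. 1] [cite: MazurRubin2010, Prop. 3.3] -/
@[conjecture] def ResidueNegDoorVisibleFourAtTwo : Prop :=
  ∀ (W : WeierstrassCurve ℚ) [W.IsElliptic] [W.IsGloballyMinimal] [W.IsIntegral ℤ], OnResidueNegAtTwo W →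
    ∀ (d : ℤ) (q₀ : ℕ) [Fact q₀.Prime], TranspAdmissible W d q₀ → MeetsNonNormAt W q₀ →
      (W.quadraticTwist (d : ℚ)).entireLFunction 1 ≠ 0 →
        ∀ (Wd : WeierstrassCurve ℚ) [Wd.IsElliptic] [Wd.IsGloballyMinimal] (Cd : WeierstrassCurve.VariableChange ℚ),
          Cd • W.quadraticTwist (d : ℚ) = Wd →
            ∃ q : ℚ, shaAn Wd = (q : ℂ) ∧ 2 ≤ padicValRat 2 q

/-- **DESC-27-ST `ResidueNegDoorDissolvedOddAtTwo` (BSD₂ CANDIDATE, the `Δ < 0` analogue of DESC-27-S).** On the `Δ < 0` residue, at a met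
transposition door whose twin has analytic rank `2`: `#Ш_an` of a minimal model of the twin is a rational `2`-adic unit. Census §27-add1 (PT-4: 4 407/0,
dim 2, r_an = 2, full saturated basis ⇒ Ш_an odd; PT-4b kPin = −1 iff Pdiv = 0, 4 407/0).
REF1 §149: SURVIVES AS TYPED, CONJECTURE-GRADE, but (exactly as §146 S) it BUNDLES the rank conjecture at r_an = 2 with BSD₂ — `∃ q, shaAn Wd = q` already
contains «r_an(E^d) = 2 ⇒ r_MW(E^d) = 2» (no converse theorem at analytic rank 2), and the census tested twins with r_MW = r_an = 2, i.e. the habitat of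
REF1's PREFERRED rider ST′ `ResidueNegDoorDissolvedOddAtTwoMW` (below, + binder `Wd.mordellWeilRank = 2`; kernel glue `dissolvedOddMW_of_dissolvedOdd :
ST → ST′`); the 2-part proper: r_MW(E^d) = 2 ⇒ (YT, proved) `Ш(E^d)[2] = 0` ⇒ BSD₂ `v₂(Ш_an) = 0`.  REF2 v43 §3: no Gross–Zagier–Kolyvagin at analytic rank 2
(only the algebraic YT is kernel); conjecture-grade; dissolution print [cite: CremonaMazur2000] [cite: Bruin2004, Thm. 1.2].  `@[conjecture]`: nothing asserted. -/
@[conjecture] def ResidueNegDoorDissolvedOddAtTwo : Prop :=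
  ∀ (W : WeierstrassCurve ℚ) [W.IsElliptic] [W.IsGloballyMinimal] [W.IsIntegral ℤ], OnResidueNegAtTwo W →
    ∀ (d : ℤ) (q₀ : ℕ) [Fact q₀.Prime], TranspAdmissible W d q₀ → MeetsNonNormAt W q₀ →
      ∀ (Wd : WeierstrassCurve ℚ) [Wd.IsElliptic] [Wd.IsGloballyMinimal] (Cd : WeierstrassCurve.VariableChange ℚ),
        Cd • W.quadraticTwist (d : ℚ) = Wd → Wd.analyticRank = 2 →
          ∃ q : ℚ, shaAn Wd = (q : ℂ) ∧ padicValRat 2 q = 0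

/-! ### REF1 §149 rider ST′ (typed VERBATIM from `HOME/REF1-data/b149/lean/Probe149.lean` bc5acd0a7fbd8e46) -/

/-- **Rider ST′ `ResidueNegDoorDissolvedOddAtTwoMW`** (REF1 §149, same repair as §146 S′; REF1's PREFERRED body for the dissolution row): ST with the
twin's MORDELL–WEIL rank `2` as an extra binder, so that the row no longer contains «r_an(W^d) = 2 ⇒ r_MW(W^d) = 2» (converse-rank-grade) and
`Ш(W^d)[2] = 0` is the KERNEL theorem YT; both clauses (`shaAn ∈ ℚ`, `v₂ = 0`) remain BSD-grade in rank 2 (no Gross–Zagier formula in rank 2: rationality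
of `L″(E^d,1)/(Ω·Reg)` is itself open).  Habitat witness (REF1): 26743b1, door (−127, 127), r_an = r_MW = 2, Ш_an = 1.  `@[conjecture]`: a BSD-slice,
nothing asserted. [cite: CremonaMazur2000] [cite: Bruin2004, Thm. 1.2] -/
@[conjecture] def ResidueNegDoorDissolvedOddAtTwoMW : Prop :=
  ∀ (W : WeierstrassCurve ℚ) [W.IsElliptic] [W.IsGloballyMinimal] [W.IsIntegral ℤ], OnResidueNegAtTwo W →
    ∀ (d : ℤ) (q₀ : ℕ) [Fact q₀.Prime], TranspAdmissible W d q₀ → MeetsNonNormAt W q₀ →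
      ∀ (Wd : WeierstrassCurve ℚ) [Wd.IsElliptic] [Wd.IsGloballyMinimal] (Cd : WeierstrassCurve.VariableChange ℚ),
        Cd • W.quadraticTwist (d : ℚ) = Wd → Wd.analyticRank = 2 → Wd.mordellWeilRank = 2 →
          ∃ q : ℚ, shaAn Wd = (q : ℂ) ∧ padicValRat 2 q = 0

/-- KERNEL glue (REF1 §149, Probe149 verbatim): ST ⇒ ST′ (the rider only adds a binder). -/
theorem dissolvedOddMW_of_dissolvedOdd (h : ResidueNegDoorDissolvedOddAtTwo) : ResidueNegDoorDissolvedOddAtTwoMW :=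
  fun W _ _ _ hW d q₀ _ hd hm Wd _ _ Cd hC hra _ ↦ h W hW d q₀ hd hm Wd Cd hC hra

/-- Bookkeeping sanity (REF1 §149 J1): on the `Δ < 0` residue the transported count RT's `4` is literally `shaTwoCard W` (the §27 file's declaration). -/
theorem shaTwoCard_eq_four_of_onResidueNeg (W : WeierstrassCurve ℚ) (h : OnResidueNegAtTwo W) : shaTwoCard W = 4 := h.2.2.2

end Summit.BirchSwinnertonDyer.Rank1Residual.F1Sign2.TranspDoorVisibility

end
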